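import Literature.Topology.FourManifolds.HeightTwoCriticalBall
import Literature.Topology.FourManifolds.HandlebodyBall
import HarnessLib

/-!
# The exp-height function with critical points of index at most one

Topic `Literature/Topology/FourManifolds`; continuation of `ExpHeightCritical.lean` /
`ExpHeightBall.lean` for the fact seat of Alexander's theorem
(`provefact-Literature.Topology.FourManifolds.SphereEmbedding.schoenflies_exists_ball`,
Schultens, *Introduction to 3-Manifolds* (2014), Thm. 3.2.5).  **Everything in this file is
proved; no definitions, no named facts.**

`ExpHeightCritical.lean` treats a compact regular domain `A = {F ≤ 0} ⊂ E` with a *unique*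
upward-normal boundary point at which the height is a nondegenerate maximum: then
`G = e^{t⟪v,·⟫} F` has a unique critical point near `A`, a nondegenerate minimum, and `A` is a
ball.  Here the upward-normal points (`DF(p) = c ⟪v, ·⟫`, `c > 0`) may be several, and at each
of them the height `⟪v, ·⟫|∂A` is only required to have a nondegenerate critical point which is
**not a local minimum** — in the language of `F`: `D²F(p)|vᗮ` is nondegenerate and positive on a
subspace of codimension `≤ 1` of `vᗮ`.  Then, for `t` large:

* `ExpHeight.exists_forall_critical_pos_subspace` — **every critical point of `G` near `A` lies
  in `{F < 0}` and its Hessian is positive on a subspace of codimension `≤ 1`, with a negative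
  vector when that subspace is proper**; so `G` is Morse near `A`, `0` is a regular level, and
  all critical points have index `≤ 1`.  Ingredients: finitely many balls around upward-normal
  points cover the compact cone set (`exists_pos_forall_mem_of_cone` of
  `ExpHeightCritical.lean`, `exists_local_data`); the Schur-complement estimate
  `fderiv_fderiv_expHeight_pos_of_mem` (`D²G = e^{th}(D²F - t² F v ⊗ v)` at a critical point,
  with `-t² F ≈ c t → ∞`); negativity of `D²F(x)(w, w)`, `w ⊥ v`, passes to `D²G`
  (`fderiv_fderiv_expHeight_neg_of_inner_eq_zero`); and the linear algebra of forms positive on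
  a large subspace (`sigNeg_add_finrank_le`, `eq_zero_of_forall_apply_eq_zero`,
  `pos_or_exists_neg_of_nondegenerate`).
* `ExpHeight.exists_regularSublevel_isHandlebodyOfIndexLE_one` — **manifold form**: `A`, as the
  regular sublevel set of `G` on the open neighbourhood `{F < η} ∩ (1-thickening of A)`, is
  compact and a handlebody with handles of index `≤ 1` (`IsHandlebodyOfIndexLE n 1`, via
  `RegularSublevel.morseData`).

With `HandlebodyBall.nonempty_diffeomorph_closedBall_of_index_le_one` this recognises as a ball
every region in `ℝ³` bounded by a sphere whose height function has a **unique local maximum**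
(apply the above to `-v`: the downward-normal points are then minima or saddles of the height,
never maxima), in particular Schultens' case `n = 1` of the proof of Thm. 3.2.5 (one saddle, so
two minima and one maximum or two maxima and one minimum; Schultens (2014), PDF p. 44) without
cutting along the singular figure-eight level; the assembly with the boundary identification is
carried out in a sequel file.

## References

* J. Schultens, *Introduction to 3-Manifolds*, GSM 151, AMS (2014), proof of Thm. 3.2.5, case
  `n = 1` (PDF p. 44 of the held copy `book:schultens2014-introduction-3-manifolds`).
  [Schultens2014]
* J. Milnor, *Morse theory* (1963), §2 (nondegenerate critical points, index), §3 (Thm. 3.2).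
  [Milnor1963]
-/

open scoped RealInnerProductSpace Topology Manifold ContDiff
open Set Filter Metric Module

noncomputable section

namespace Literature.Topology.FourManifolds

namespace ExpHeight

variable {E : Type*} [NormedAddCommGroup E] [InnerProductSpace ℝ E]

/-! ### §1 Local constants at an upward-normal point with a positive subspace -/

section Local

variable [FiniteDimensional ℝ E] {F : E → ℝ} {v : E}

/-- **Uniform positivity on a subspace.** A bilinear form positive on the nonzero vectors of
a subspace `P` is bounded below there by `q ‖w‖²` for some `q > 0` (compactness of the unit
sphere of `P`). [folklore] -/
theorem exists_pos_mul_norm_sq_le_of_mem (D : E →L[ℝ] E →L[ℝ] ℝ) (P : Submodule ℝ E)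
    (hpos : ∀ w ∈ P, w ≠ 0 → 0 < D w w) :
    ∃ q, 0 < q ∧ ∀ w ∈ P, q * ‖w‖ ^ 2 ≤ D w w := by
  set S : Set E := sphere (0 : E) 1 ∩ (P : Set E) with hS
  have hSc : IsCompact S := (isCompact_sphere 0 1).inter_right P.closed_of_finiteDimensional
  have hcont : Continuous fun w : E => D w w :=
    (D.continuous₂).comp (continuous_id.prodMk continuous_id)
  have key : ∀ q, (∀ w ∈ S, q ≤ D w w) → ∀ w ∈ P, q * ‖w‖ ^ 2 ≤ D w w := by
    intro q hq w hwP
    by_cases hw : w = 0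
    · subst hw; simp
    · have hn : ‖w‖ ≠ 0 := norm_ne_zero_iff.2 hw
      have hmem : ‖w‖⁻¹ • w ∈ S := by
        refine ⟨?_, P.smul_mem _ hwP⟩
        simp [norm_smul, inv_mul_cancel₀ hn]
      have h1 := hq _ hmem
      have h2 : D (‖w‖⁻¹ • w) (‖w‖⁻¹ • w) = (‖w‖ ^ 2)⁻¹ * D w w := by
        simp only [map_smul, FunLike.coe_smul, Pi.smul_apply, smul_eq_mul]
        rw [← mul_assoc, ← mul_inv, ← pow_two]
      rw [h2] at h1
      have h3 : 0 < ‖w‖ ^ 2 := by positivity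
      have := mul_le_mul_of_nonneg_left h1 h3.le
      rwa [← mul_assoc, mul_inv_cancel₀ h3.ne', one_mul, mul_comm] at this
  by_cases hne : S.Nonempty
  · obtain ⟨w₀, hw₀, hmin⟩ := hSc.exists_isMinOn hne hcont.continuousOn
    have hw₀ne : w₀ ≠ 0 := by
      intro h; rw [h] at hw₀; simp [hS] at hw₀
    exact ⟨D w₀ w₀, hpos w₀ hw₀.2 hw₀ne, key _ fun w hw => hmin hw⟩
  · exact ⟨1, one_pos, key 1 fun w hw => (hne ⟨w, hw⟩).elim⟩

/-- **Local constants at an upward-normal point, subspace form.** If `DF(p₀) = c₀ ⟪v,·⟫` with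
`c₀ > 0` and `D²F(p₀)` is positive on the nonzero vectors of a subspace `P`, then on a small
ball around `p₀`: `D²F(x)(w,w) ≥ q ‖w‖²` for `w ∈ P`, `‖D²F(x)‖ ≤ M`, `DF(x) v̂ ≥ n₀`, with
explicit positive constants. [folklore] -/
theorem exists_local_constants_of_subspace (hF : ContDiff ℝ 2 F) (hv : v ≠ 0) {p₀ : E} {c₀ : ℝ}
    (hc₀ : 0 < c₀) (hDp₀ : fderiv ℝ F p₀ = c₀ • innerSL ℝ v) (P : Submodule ℝ E)
    (hpos : ∀ w ∈ P, w ≠ 0 → 0 < fderiv ℝ (fderiv ℝ F) p₀ w w) :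
    ∃ q M n₀ ρ : ℝ, 0 < q ∧ 0 < M ∧ 0 < n₀ ∧ 0 < ρ ∧ ρ ≤ 1 ∧
      (∀ x ∈ ball p₀ ρ, ∀ w ∈ P, q * ‖w‖ ^ 2 ≤ fderiv ℝ (fderiv ℝ F) x w w) ∧
      (∀ x ∈ ball p₀ ρ, ‖fderiv ℝ (fderiv ℝ F) x‖ ≤ M) ∧
      (∀ x ∈ ball p₀ ρ, n₀ ≤ fderiv ℝ F x (‖v‖⁻¹ • v)) := by
  have hF1 : ContDiff ℝ 1 (fderiv ℝ F) := ((contDiff_succ_iff_fderiv (n := 1)).1 hF).2.2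
  have hDc : Continuous (fderiv ℝ F) := hF.continuous_fderiv (by norm_num)
  have hD2c : Continuous (fderiv ℝ (fderiv ℝ F)) := hF1.continuous_fderiv one_ne_zero
  set D2 := fderiv ℝ (fderiv ℝ F) with hD2
  obtain ⟨q, hq, hQ0⟩ := exists_pos_mul_norm_sq_le_of_mem (D2 p₀) P hpos
  have hvn : 0 < ‖v‖ := norm_pos_iff.2 hv
  set M : ℝ := ‖D2 p₀‖ + 1 with hM
  have hM0 : 0 < M := by positivity
  set n₀ : ℝ := c₀ * ‖v‖ / 2 with hn₀
  have hn₀0 : 0 < n₀ := by positivity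
  have h1 := ((tendsto_iff_norm_sub_tendsto_zero (f := D2) (b := D2 p₀)).1
    (hD2c.tendsto p₀)).eventually (gt_mem_nhds (lt_min (half_pos hq) one_pos))
  have h2 := ((tendsto_iff_norm_sub_tendsto_zero (f := fun x => fderiv ℝ F x (‖v‖⁻¹ • v))
    (b := fderiv ℝ F p₀ (‖v‖⁻¹ • v))).1
    ((((ContinuousLinearMap.apply ℝ ℝ (‖v‖⁻¹ • v)).continuous.comp hDc).tendsto p₀))).eventually
      (gt_mem_nhds hn₀0)
  obtain ⟨ρ₀, hρ₀, hball⟩ := Metric.eventually_nhds_iff_ball.1 (h1.and h2)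
  refine ⟨q / 2, M, n₀, min ρ₀ 1, by positivity, hM0, hn₀0, lt_min hρ₀ one_pos,
    min_le_right _ _, ?_, ?_, ?_⟩
  · intro x hx w hw
    have hx' : x ∈ ball p₀ ρ₀ := ball_subset_ball (min_le_left _ _) hx
    have hd : ‖D2 x - D2 p₀‖ < q / 2 := lt_of_lt_of_le (hball x hx').1 (min_le_left _ _)
    have hdiff : |D2 x w w - D2 p₀ w w| ≤ q / 2 * ‖w‖ ^ 2 := by
      have : D2 x w w - D2 p₀ w w = (D2 x - D2 p₀) w w := by
        simp only [sub_apply]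
      rw [this, ← Real.norm_eq_abs]
      calc ‖(D2 x - D2 p₀) w w‖ ≤ ‖D2 x - D2 p₀‖ * ‖w‖ * ‖w‖ :=
            ContinuousLinearMap.le_opNorm₂ _ _ _
        _ ≤ q / 2 * ‖w‖ * ‖w‖ := by gcongr
        _ = q / 2 * ‖w‖ ^ 2 := by ring
    have h0 := hQ0 w hw
    have := neg_abs_le (D2 x w w - D2 p₀ w w)
    show q / 2 * ‖w‖ ^ 2 ≤ D2 x w w
    linarith
  · intro x hx
    have hx' : x ∈ ball p₀ ρ₀ := ball_subset_ball (min_le_left _ _) hx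
    have hd : ‖D2 x - D2 p₀‖ < 1 := lt_of_lt_of_le (hball x hx').1 (min_le_right _ _)
    have := norm_sub_norm_le (D2 x) (D2 p₀)
    show ‖D2 x‖ ≤ ‖D2 p₀‖ + 1
    linarith
  · intro x hx
    have hx' : x ∈ ball p₀ ρ₀ := ball_subset_ball (min_le_left _ _) hx
    have hd := (hball x hx').2
    rw [Real.norm_eq_abs] at hd
    have hp : fderiv ℝ F p₀ (‖v‖⁻¹ • v) = 2 * n₀ := by
      rw [hDp₀, FunLike.coe_smul, Pi.smul_apply, innerSL_apply_apply,
        inner_self_unitVec hv, smul_eq_mul, hn₀]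
      ring
    rw [hp] at hd
    have := neg_abs_le (fderiv ℝ F x (‖v‖⁻¹ • v) - 2 * n₀)
    linarith [abs_lt.1 hd]

omit [FiniteDimensional ℝ E] in
/-- **Positivity of the Hessian on `P ⊕ ℝv` at a critical point near an upward-normal point.**
With the local bounds of `exists_local_constants_of_subspace` for a subspace `P ⊆ vᗮ` and
`t ‖v‖ n₀ ≥ 2 M² / q + M + 1`, the Hessian of `e^{t⟪v,·⟫} F` at a critical point `x ∈ W` is
positive on the nonzero vectors of `P + ℝ v`: for `u = w + s v̂` with `w ∈ P`,
`D²G(x)(u,u) ≥ e^{t⟪v,x⟫} (q ‖w‖² - 2 M |s| ‖w‖ - M s² + t ‖v‖ n₀ s²) > 0` (same estimate as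
`fderiv_fderiv_expHeight_pos`). [folklore] -/
theorem fderiv_fderiv_expHeight_pos_of_mem (hF : ContDiff ℝ 2 F) (hv : v ≠ 0) {W : Set E}
    {q M n₀ t : ℝ} (hq : 0 < q) (hn₀ : 0 < n₀) {P : Submodule ℝ E}
    (hPv : ∀ w ∈ P, ⟪v, w⟫ = 0)
    (hQ : ∀ x ∈ W, ∀ w ∈ P, q * ‖w‖ ^ 2 ≤ fderiv ℝ (fderiv ℝ F) x w w)
    (hMb : ∀ x ∈ W, ‖fderiv ℝ (fderiv ℝ F) x‖ ≤ M)
    (hn : ∀ x ∈ W, n₀ ≤ fderiv ℝ F x (‖v‖⁻¹ • v))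
    (ht : 2 * M ^ 2 / q + M + 1 ≤ t * ‖v‖ * n₀)
    {x : E} (hxW : x ∈ W) (hx : fderiv ℝ (fun x => Real.exp (t * ⟪v, x⟫) * F x) x = 0)
    {u : E} (huP : u ∈ P ⊔ (ℝ ∙ v)) (hu : u ≠ 0) :
    0 < fderiv ℝ (fderiv ℝ (fun x => Real.exp (t * ⟪v, x⟫) * F x)) x u u := by
  have hFd : Differentiable ℝ F := hF.differentiable (by norm_num)
  have hM0 : 0 ≤ M := le_trans (norm_nonneg (fderiv ℝ (fderiv ℝ F) x)) (hMb x hxW)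
  have hvn : 0 < ‖v‖ := norm_pos_iff.2 hv
  have ht0 : 0 < t := by
    by_contra h
    push Not at h
    have h1 : t * ‖v‖ * n₀ ≤ 0 :=
      mul_nonpos_of_nonpos_of_nonneg (mul_nonpos_of_nonpos_of_nonneg h hvn.le) hn₀.le
    have h2 : 0 ≤ 2 * M ^ 2 / q := by positivity
    linarith
  set w := (u - ⟪‖v‖⁻¹ • v, u⟫ • (‖v‖⁻¹ • v)) with hw
  set s := ⟪‖v‖⁻¹ • v, u⟫ with hs
  have hvw : ⟪v, w⟫ = 0 := inner_perpV hv u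
  have e1 : u = w + s • (‖v‖⁻¹ • v) := by rw [hw, hs, perpV_add]
  -- `w ∈ P`
  have hwP : w ∈ P := by
    obtain ⟨p, hp, z, hz, hpz⟩ := Submodule.mem_sup.1 huP
    obtain ⟨a, rfl⟩ := Submodule.mem_span_singleton.1 hz
    have hsu : s = a * ‖v‖ := by
      rw [hs, ← hpz, inner_add_right, inner_unitVec_left, hPv p hp, mul_zero, zero_add,
        inner_smul_right, inner_unitVec_left, real_inner_self_eq_norm_sq]
      field_simp
    have : w = p := by
      rw [hw, hsu, ← hpz, smul_smul, mul_assoc, mul_inv_cancel₀ hvn.ne', mul_one,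
        add_sub_cancel_right]
    rw [this]; exact hp
  -- the value of `DF(x) u` and of `⟪v, u⟫`
  have hvu : ⟪v, u⟫ = s * ‖v‖ := inner_eq_coordV_mul hv u
  have hnx : n₀ ≤ fderiv ℝ F x (‖v‖⁻¹ • v) := hn x hxW
  have hFx : fderiv ℝ F x (‖v‖⁻¹ • v) = -(t * F x) * ‖v‖ := by
    rw [fderiv_apply_of_critical (hFd x) hx, inner_self_unitVec hv]
  have hDu : fderiv ℝ F x u = -(t * F x) * (s * ‖v‖) := by
    rw [fderiv_apply_of_critical (hFd x) hx, hvu]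
  set D := fderiv ℝ (fderiv ℝ F) x with hD
  have hDexp : D u u = D w w + s * D w (‖v‖⁻¹ • v) + s * D (‖v‖⁻¹ • v) w +
      s * s * D (‖v‖⁻¹ • v) (‖v‖⁻¹ • v) := by
    rw [e1]
    simp only [map_add, map_smul, add_apply, FunLike.coe_smul,
      Pi.smul_apply, smul_eq_mul]
    ring
  have hb : ∀ a b : E, |D a b| ≤ M * ‖a‖ * ‖b‖ := fun a b => by
    rw [← Real.norm_eq_abs]
    exact (ContinuousLinearMap.le_opNorm₂ D a b).trans (by gcongr; exact hMb x hxW)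
  have h1 : |D w (‖v‖⁻¹ • v)| ≤ M * ‖w‖ := by simpa [norm_unitVec hv] using hb w (‖v‖⁻¹ • v)
  have h2 : |D (‖v‖⁻¹ • v) w| ≤ M * ‖w‖ := by simpa [norm_unitVec hv] using hb (‖v‖⁻¹ • v) w
  have h3 : |D (‖v‖⁻¹ • v) (‖v‖⁻¹ • v)| ≤ M := by
    simpa [norm_unitVec hv] using hb (‖v‖⁻¹ • v) (‖v‖⁻¹ • v)
  have hQw : q * ‖w‖ ^ 2 ≤ D w w := hQ x hxW w hwP
  have hformula : fderiv ℝ (fderiv ℝ (fun x => Real.exp (t * ⟪v, x⟫) * F x)) x u u =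
      Real.exp (t * ⟪v, x⟫) * (D u u + t * ‖v‖ * fderiv ℝ F x (‖v‖⁻¹ • v) * s ^ 2) := by
    rw [fderiv_fderiv_expHeight_of_critical hF hx, hDu, hvu, hFx]
    ring
  rw [hformula]
  refine mul_pos (Real.exp_pos _) ?_
  have hlow : q * ‖w‖ ^ 2 - 2 * M * |s| * ‖w‖ - M * s ^ 2 + t * ‖v‖ * n₀ * s ^ 2 ≤
      D u u + t * ‖v‖ * fderiv ℝ F x (‖v‖⁻¹ • v) * s ^ 2 := by
    rw [hDexp]
    have e2 : -(|s| * (M * ‖w‖)) ≤ s * D w (‖v‖⁻¹ • v) := by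
      have h0 := neg_abs_le (s * D w (‖v‖⁻¹ • v))
      rw [abs_mul] at h0
      have := mul_le_mul_of_nonneg_left h1 (abs_nonneg s)
      linarith
    have e3 : -(|s| * (M * ‖w‖)) ≤ s * D (‖v‖⁻¹ • v) w := by
      have h0 := neg_abs_le (s * D (‖v‖⁻¹ • v) w)
      rw [abs_mul] at h0
      have := mul_le_mul_of_nonneg_left h2 (abs_nonneg s)
      linarith
    have e4 : -(s * s * M) ≤ s * s * D (‖v‖⁻¹ • v) (‖v‖⁻¹ • v) := by
      have h0 := neg_abs_le (s * s * D (‖v‖⁻¹ • v) (‖v‖⁻¹ • v))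
      rw [abs_mul, abs_mul_self] at h0
      have := mul_le_mul_of_nonneg_left h3 (mul_self_nonneg s)
      linarith
    have e5 : t * ‖v‖ * s ^ 2 * n₀ ≤ t * ‖v‖ * s ^ 2 * fderiv ℝ F x (‖v‖⁻¹ • v) :=
      mul_le_mul_of_nonneg_left hnx (by positivity)
    have hss : s * s = s ^ 2 := (sq s).symm
    have hsa : |s| * |s| = s ^ 2 := by rw [← sq, sq_abs]
    nlinarith [hQw, e2, e3, e4, e5, hss, hsa]
  refine lt_of_lt_of_le ?_ hlow
  by_cases hs0 : s = 0
  · have hw0 : w ≠ 0 := by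
      intro hw0
      exact hu (eq_zero_of_perpV_eq_zero hv (hw ▸ hw0) (hs ▸ hs0))
    have : 0 < ‖w‖ := norm_pos_iff.2 hw0
    rw [hs0]
    simp only [abs_zero, mul_zero, zero_mul, sub_zero, add_zero, ne_eq, OfNat.ofNat_ne_zero,
      not_false_eq_true, zero_pow]
    positivity
  · have hspos : 0 < s ^ 2 := by positivity
    have key : 0 ≤ q * ‖w‖ ^ 2 - 2 * M * |s| * ‖w‖ + 2 * M ^ 2 / q * |s| ^ 2 := by
      have : q * ‖w‖ ^ 2 - 2 * M * |s| * ‖w‖ + 2 * M ^ 2 / q * |s| ^ 2 =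
          q * (‖w‖ - M / q * |s|) ^ 2 + M ^ 2 / q * |s| ^ 2 := by
        field_simp
        ring
      rw [this]
      positivity
    rw [sq_abs] at key
    have ht' : (2 * M ^ 2 / q + M + 1) * s ^ 2 ≤ t * ‖v‖ * n₀ * s ^ 2 :=
      mul_le_mul_of_nonneg_right ht hspos.le
    linarith

omit [FiniteDimensional ℝ E] in
/-- **Negativity persists.** At a critical point `x` of `e^{t⟪v,·⟫} F`, for `w ⊥ v` the Hessian
is `e^{t⟪v,x⟫} D²F(x)(w,w)`; so a direction `w ⊥ v` with `D²F(x)(w,w) < 0` is a negative direction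
of the Hessian of the exp-height function. [folklore] -/
theorem fderiv_fderiv_expHeight_neg_of_inner_eq_zero (hF : ContDiff ℝ 2 F) {t : ℝ} {x w : E}
    (hx : fderiv ℝ (fun x => Real.exp (t * ⟪v, x⟫) * F x) x = 0) (hw : ⟪v, w⟫ = 0)
    (hneg : fderiv ℝ (fderiv ℝ F) x w w < 0) :
    fderiv ℝ (fderiv ℝ (fun x => Real.exp (t * ⟪v, x⟫) * F x)) x w w < 0 := by
  rw [fderiv_fderiv_expHeight_of_critical hF hx, hw, mul_zero, add_zero]
  exact mul_neg_of_pos_of_neg (Real.exp_pos _) hneg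

end Local

/-! ### §2 Linear algebra of a form positive on a large subspace -/

section LinAlg

variable [FiniteDimensional ℝ E]

/-- If a bilinear form is nonnegative on a subspace `V` then its negative index of inertia is
at most `dim E - dim V` (Sylvester: `sigPos_add_finrank_le_of_nonpos` for `-B`). [folklore] -/
theorem sigNeg_add_finrank_le (B : LinearMap.BilinForm ℝ E) (V : Submodule ℝ E)
    (hV : ∀ u ∈ V, 0 ≤ B u u) :
    sigNeg B.toQuadraticMap + finrank ℝ V ≤ finrank ℝ E := by
  have h := QuadraticForm.sigPos_add_finrank_le_of_nonpos (Q := -B.toQuadraticMap) (V := V)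
    (fun u hu => by
      rw [QuadraticMap.neg_apply, neg_nonpos, LinearMap.BilinMap.toQuadraticMap_apply]
      exact hV u hu)
  rwa [sigPos_neg] at h

/-- **Nondegeneracy from a positive hyperplane and a negative vector.** If a symmetric bilinear
map `H` is positive on the nonzero vectors of a subspace `V` with `dim E ≤ dim V + 1` and
either `V = E` or some vector `wn` has `H(wn, wn) < 0`, then `H` is nondegenerate:
`H(u, ·) = 0` forces `u = 0`. [folklore] -/
theorem eq_zero_of_forall_apply_eq_zero (H : E →L[ℝ] E →L[ℝ] ℝ) (hsym : ∀ u w, H u w = H w u)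
    (V : Submodule ℝ E) (hV : ∀ u ∈ V, u ≠ 0 → 0 < H u u) (hdim : finrank ℝ E ≤ finrank ℝ V + 1)
    (hneg : V ≠ ⊤ → ∃ w, H w w < 0) {u : E} (hu : ∀ w, H u w = 0) : u = 0 := by
  by_cases hVtop : V = ⊤
  · by_contra hu0
    have h := hV u (hVtop ▸ Submodule.mem_top) hu0
    rw [hu u] at h
    exact lt_irrefl _ h
  obtain ⟨wn, hwn⟩ := hneg hVtop
  -- `wn ∉ V`, hence `V ⊔ ℝ wn = ⊤` by dimension count
  have hwV : wn ∉ V := fun h => by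
    by_cases h0 : wn = 0
    · rw [h0] at hwn; simp at hwn
    · exact lt_asymm hwn (hV wn h h0)
  have hw0 : wn ≠ 0 := fun h0 => hwV (h0 ▸ V.zero_mem)
  have hinf : V ⊓ (ℝ ∙ wn) = ⊥ := by
    rw [Submodule.eq_bot_iff]
    rintro z ⟨hzV, hzw⟩
    obtain ⟨a, rfl⟩ := Submodule.mem_span_singleton.1 hzw
    by_contra hne
    have ha : a ≠ 0 := fun ha => hne (by rw [ha, zero_smul])
    exact hwV (by simpa [smul_smul, inv_mul_cancel₀ ha] using V.smul_mem a⁻¹ hzV)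
  have htop : V ⊔ (ℝ ∙ wn) = ⊤ := by
    apply Submodule.eq_top_of_finrank_eq
    have h1 := Submodule.finrank_sup_add_finrank_inf_eq V (ℝ ∙ wn)
    rw [hinf, finrank_bot, add_zero, finrank_span_singleton hw0] at h1
    have h2 : finrank ℝ ↥(V ⊔ (ℝ ∙ wn)) ≤ finrank ℝ E := Submodule.finrank_le _
    omega
  -- decompose `u = up + a wn`
  have huE : u ∈ V ⊔ (ℝ ∙ wn) := by rw [htop]; exact Submodule.mem_top
  obtain ⟨up, hup, z, hz, huz⟩ := Submodule.mem_sup.1 huE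
  obtain ⟨a, rfl⟩ := Submodule.mem_span_singleton.1 hz
  have e1 : H u up = 0 := hu up
  have e2 : H u wn = 0 := hu wn
  rw [← huz, map_add, map_smul, add_apply, smul_apply,
    smul_eq_mul] at e1 e2
  -- `H(up,up) + a H(wn,up) = 0` and `H(up,wn) + a H(wn,wn) = 0`
  have e3 : H up up - a ^ 2 * H wn wn = 0 := by
    have h4 : H wn up = H up wn := hsym wn up
    linear_combination e1 - a * e2 - a * h4
  have hpos : 0 ≤ H up up := by
    by_cases h0 : up = 0
    · simp [h0]
    · exact (hV up hup h0).le
  have ha2 : 0 ≤ -(a ^ 2 * H wn wn) := by nlinarith [sq_nonneg a]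
  have hup0 : H up up = 0 := by linarith
  have hupz : up = 0 := by
    by_contra h0
    exact absurd hup0 (hV up hup h0).ne'
  have ha0 : a = 0 := by
    have : a ^ 2 * H wn wn = 0 := by linarith
    rcases mul_eq_zero.1 this with h | h
    · exact pow_eq_zero_iff two_ne_zero |>.1 h
    · exact absurd h hwn.ne
  rw [← huz, hupz, ha0, zero_smul, add_zero]

/-- **Dichotomy for a nondegenerate form positive on a hyperplane.** Let `S` be a subspace,
`P ⊆ S` a subspace with `dim S ≤ dim P + 1`, and `H` a symmetric bilinear map which is positive on
the nonzero vectors of `P` and nondegenerate on `S`.  Then `H` is positive on the nonzero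
vectors of `S`, or some `w ∈ S` has `H(w, w) < 0` (look at a vector of `S` that is
`H`-orthogonal to `P`, which exists by rank–nullity). [folklore] -/
theorem pos_or_exists_neg_of_nondegenerate (H : E →L[ℝ] E →L[ℝ] ℝ) (hsym : ∀ u w, H u w = H w u)
    (S P : Submodule ℝ E) (hPS : P ≤ S) (hdim : finrank ℝ S ≤ finrank ℝ P + 1)
    (hP : ∀ w ∈ P, w ≠ 0 → 0 < H w w)
    (hnd : ∀ w ∈ S, (∀ u ∈ S, H w u = 0) → w = 0) :
    (∀ w ∈ S, w ≠ 0 → 0 < H w w) ∨ ∃ w ∈ S, H w w < 0 := by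
  by_cases hPeq : finrank ℝ S ≤ finrank ℝ P
  · -- `P = S`
    have hPS' : P = S := Submodule.eq_of_le_of_finrank_le hPS hPeq
    left
    intro w hw hw0
    exact hP w (hPS' ▸ hw) hw0
  push Not at hPeq
  -- a nonzero `w₁ ∈ S` with `H(w₁, p) = 0` for all `p ∈ P`
  obtain ⟨w₁, hw₁S, hw₁0, hw₁P⟩ : ∃ w₁ ∈ S, w₁ ≠ 0 ∧ ∀ p ∈ P, H w₁ p = 0 := by
    -- the linear map `S → Dual P`, `w ↦ H(w, ·)|P`
    let T : S →ₗ[ℝ] Module.Dual ℝ P :=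
      { toFun := fun w =>
          { toFun := fun p => H (w : E) (p : E)
            map_add' := fun p p' => by simp
            map_smul' := fun c p => by simp }
        map_add' := fun w w' => by ext p; simp
        map_smul' := fun c w => by ext p; simp }
    have hrank : finrank ℝ (LinearMap.range T) + finrank ℝ (LinearMap.ker T) = finrank ℝ S :=
      LinearMap.finrank_range_add_finrank_ker T
    have hr : finrank ℝ (LinearMap.range T) ≤ finrank ℝ P :=
      (Submodule.finrank_le _).trans (by rw [Subspace.dual_finrank_eq])
    have hker : 0 < finrank ℝ (LinearMap.ker T) := by omega
    obtain ⟨w, hwk, hw0⟩ := Submodule.exists_mem_ne_zero_of_ne_bot (p := LinearMap.ker T)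
      (fun h => by rw [h, finrank_bot] at hker; exact lt_irrefl _ hker)
    refine ⟨(w : E), w.2, fun h => hw0 (Subtype.ext h), fun p hp => ?_⟩
    have := LinearMap.mem_ker.1 hwk
    have := congrArg (fun φ : Module.Dual ℝ P => φ ⟨p, hp⟩) this
    simpa [T] using this
  have hw₁nP : w₁ ∉ P := fun h => by
    have h1 := hP w₁ h hw₁0
    rw [hw₁P w₁ h] at h1
    exact lt_irrefl _ h1
  -- `P ⊔ ℝ w₁ = S`
  have hsup : P ⊔ (ℝ ∙ w₁) = S := by
    apply Submodule.eq_of_le_of_finrank_le (sup_le hPS ((Submodule.span_singleton_le_iff_mem _ _).2 hw₁S))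
    have hinf : P ⊓ (ℝ ∙ w₁) = ⊥ := by
      rw [Submodule.eq_bot_iff]
      rintro z ⟨hzP, hzw⟩
      obtain ⟨a, rfl⟩ := Submodule.mem_span_singleton.1 hzw
      by_contra hne
      have ha : a ≠ 0 := fun ha => hne (by rw [ha, zero_smul])
      exact hw₁nP (by simpa [smul_smul, inv_mul_cancel₀ ha] using P.smul_mem a⁻¹ hzP)
    have h1 := Submodule.finrank_sup_add_finrank_inf_eq P (ℝ ∙ w₁)
    rw [hinf, finrank_bot, add_zero, finrank_span_singleton hw₁0] at h1
    omega
  have hdec : ∀ u ∈ S, ∃ p ∈ P, ∃ a : ℝ, p + a • w₁ = u := by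
    intro u hu
    rw [← hsup] at hu
    obtain ⟨p, hp, z, hz, hpz⟩ := Submodule.mem_sup.1 hu
    obtain ⟨a, rfl⟩ := Submodule.mem_span_singleton.1 hz
    exact ⟨p, hp, a, hpz⟩
  rcases lt_trichotomy (H w₁ w₁) 0 with hlt | heq | hgt
  · exact Or.inr ⟨w₁, hw₁S, hlt⟩
  · -- `w₁` would be in the radical of `H|S`
    exfalso
    refine hw₁0 (hnd w₁ hw₁S fun u hu => ?_)
    obtain ⟨p, hp, a, rfl⟩ := hdec u hu
    rw [map_add, map_smul, smul_eq_mul, hw₁P p hp, heq, mul_zero, add_zero]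
  · left
    intro u hu hu0
    obtain ⟨p, hp, a, rfl⟩ := hdec u hu
    have hcross : H p w₁ = 0 := by rw [hsym, hw₁P p hp]
    have hexp : H (p + a • w₁) (p + a • w₁) = H p p + a ^ 2 * H w₁ w₁ := by
      simp only [map_add, map_smul, add_apply, smul_apply,
        smul_eq_mul, hcross, hw₁P p hp]
      ring
    rw [hexp]
    by_cases hp0 : p = 0
    · have ha : a ≠ 0 := by
        rintro rfl; exact hu0 (by rw [hp0, zero_smul, add_zero])
      simp only [hp0, map_zero, zero_add]
      positivity
    · have := hP p hp hp0
      positivity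

end LinAlg

/-! ### §3 Critical points of the exp-height function have index at most one -/

section Global

variable [FiniteDimensional ℝ E] {F : E → ℝ} {v : E}

/-- **Local data at an upward-normal point** (dichotomy + local constants).  At a zero `p` of
`F` with `DF(p) = c ⟪v, ·⟫`, `c > 0`, where `D²F(p)|vᗮ` is nondegenerate and positive on a
subspace `P ⊆ vᗮ` of codimension `≤ 1` in `vᗮ`: either `D²F(p)` is positive on `vᗮ ∖ {0}`
(and we may enlarge `P` to `vᗮ`), or there is `wn ⊥ v` with `D²F(x)(wn, wn) < 0` for `x` near
`p`; in both cases the local constants of `exists_local_constants_of_subspace` are available on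
a small ball. [folklore] -/
theorem exists_local_data (hF : ContDiff ℝ 2 F) (hv : v ≠ 0) {p : E} {c : ℝ} (hc : 0 < c)
    (hDp : fderiv ℝ F p = c • innerSL ℝ v)
    (hnd : ∀ w, ⟪v, w⟫ = 0 → (∀ u, ⟪v, u⟫ = 0 → fderiv ℝ (fderiv ℝ F) p w u = 0) → w = 0)
    {P : Submodule ℝ E} (hPv : ∀ w ∈ P, ⟪v, w⟫ = 0) (hdimP : finrank ℝ E ≤ finrank ℝ P + 2)
    (hPpos : ∀ w ∈ P, w ≠ 0 → 0 < fderiv ℝ (fderiv ℝ F) p w w) :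
    ∃ (P' : Submodule ℝ E) (ρ q M n₀ : ℝ), 0 < ρ ∧ 0 < q ∧ 0 < M ∧ 0 < n₀ ∧
      (∀ w ∈ P', ⟪v, w⟫ = 0) ∧ finrank ℝ E ≤ finrank ℝ P' + 2 ∧
      (∀ x ∈ ball p ρ, ∀ w ∈ P', q * ‖w‖ ^ 2 ≤ fderiv ℝ (fderiv ℝ F) x w w) ∧
      (∀ x ∈ ball p ρ, ‖fderiv ℝ (fderiv ℝ F) x‖ ≤ M) ∧
      (∀ x ∈ ball p ρ, n₀ ≤ fderiv ℝ F x (‖v‖⁻¹ • v)) ∧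
      (finrank ℝ E ≤ finrank ℝ P' + 1 ∨
        ∃ w, ⟪v, w⟫ = 0 ∧ ∀ x ∈ ball p ρ, fderiv ℝ (fderiv ℝ F) x w w < 0) := by
  have hF1 : ContDiff ℝ 1 (fderiv ℝ F) := ((contDiff_succ_iff_fderiv (n := 1)).1 hF).2.2
  have hD2c : Continuous (fderiv ℝ (fderiv ℝ F)) := hF1.continuous_fderiv one_ne_zero
  set S : Submodule ℝ E := (ℝ ∙ v)ᗮ with hS
  have hmemS : ∀ w, w ∈ S ↔ ⟪v, w⟫ = 0 := fun w =>
    Submodule.mem_orthogonal_singleton_iff_inner_right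
  have hPS : P ≤ S := fun w hw => (hmemS w).2 (hPv w hw)
  have hEpos : 0 < finrank ℝ E := Module.finrank_pos_iff_exists_ne_zero.2 ⟨v, hv⟩
  haveI : Fact (finrank ℝ E = (finrank ℝ E - 1) + 1) := ⟨by omega⟩
  have hSdim : finrank ℝ S = finrank ℝ E - 1 := Submodule.finrank_orthogonal_span_singleton hv
  have hdimS : finrank ℝ S ≤ finrank ℝ P + 1 := by omega
  have hsym : ∀ u w, fderiv ℝ (fderiv ℝ F) p u w = fderiv ℝ (fderiv ℝ F) p w u := fun u w =>
    (hF.contDiffAt.isSymmSndFDerivAt (by simp)) u w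
  have hndS : ∀ w ∈ S, (∀ u ∈ S, fderiv ℝ (fderiv ℝ F) p w u = 0) → w = 0 := fun w hw h =>
    hnd w ((hmemS w).1 hw) fun u hu => h u ((hmemS u).2 hu)
  rcases pos_or_exists_neg_of_nondegenerate (fderiv ℝ (fderiv ℝ F) p) hsym S P hPS hdimS hPpos
    hndS with hposS | ⟨wn, hwnS, hwn⟩
  · -- positive on all of `vᗮ`: take `P' = vᗮ`
    obtain ⟨q, M, n₀, ρ, hq, hM, hn₀, hρ, -, hQ, hMb, hn⟩ :=
      exists_local_constants_of_subspace hF hv hc hDp S hposS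
    exact ⟨S, ρ, q, M, n₀, hρ, hq, hM, hn₀, fun w hw => (hmemS w).1 hw, by omega, hQ, hMb, hn,
      Or.inl (by omega)⟩
  · obtain ⟨q, M, n₀, ρ, hq, hM, hn₀, hρ, -, hQ, hMb, hn⟩ :=
      exists_local_constants_of_subspace hF hv hc hDp P hPpos
    -- negativity persists on a small ball
    have hcont : Continuous fun x => fderiv ℝ (fderiv ℝ F) x wn wn :=
      ((ContinuousLinearMap.apply ℝ ℝ wn).continuous.comp
        ((ContinuousLinearMap.apply ℝ (E →L[ℝ] ℝ) wn).continuous.comp hD2c))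
    obtain ⟨ρ₁, hρ₁, hneg⟩ := Metric.eventually_nhds_iff_ball.1
      ((hcont.tendsto p).eventually (gt_mem_nhds hwn))
    refine ⟨P, min ρ ρ₁, q, M, n₀, lt_min hρ hρ₁, hq, hM, hn₀, hPv, hdimP,
      fun x hx => hQ x (ball_subset_ball (min_le_left _ _) hx),
      fun x hx => hMb x (ball_subset_ball (min_le_left _ _) hx),
      fun x hx => hn x (ball_subset_ball (min_le_left _ _) hx),
      Or.inr ⟨wn, (hmemS wn).1 hwnS, fun x hx => hneg x (ball_subset_ball (min_le_right _ _) hx)⟩⟩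

/-- **Main theorem (calculus form): the exp-height function has only critical points of index
`≤ 1`.**  Let `F : E → ℝ` be `C²` with `A = {F ≤ 0}` compact and `DF ≠ 0` on `Z = {F = 0}`;
let `v ≠ 0` and suppose that at every *upward-normal* point `p ∈ Z` (`DF(p) = c ⟪v,·⟫`,
`c > 0`) the restricted Hessian `D²F(p)|vᗮ` is nondegenerate and positive on a subspace of
codimension `≤ 1` of `vᗮ` (equivalently: the height `⟪v,·⟫|Z` has at `p` a nondegenerate
critical point which is not a local minimum — a maximum or, in dimension `3`, a saddle).  Then
for a suitable rate `t > 0` and margin `η > 0`, every critical point `x` of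
`G = e^{t⟪v,·⟫} F` in the neighbourhood `{F < η} ∩ (1-thickening of A)` of `A` lies in
`{F < 0}` and its Hessian is positive on a subspace `V` of codimension `≤ 1`, with a negative
vector whenever `V ≠ E`: so `x` is nondegenerate of index `≤ 1`.  Proof: finitely many balls
around upward-normal points cover the compact cone set (`exists_pos_forall_mem_of_cone`,
`exists_local_data`); `t` exceeds all local thresholds and `sup ‖DF‖/(ε ‖v‖)`; deep and outer
points are not critical (as in `exists_unique_critical`), shallow ones lie in one of the balls
where `fderiv_fderiv_expHeight_pos_of_mem` and `fderiv_fderiv_expHeight_neg_of_inner_eq_zero`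
apply. [folklore] -/
theorem exists_forall_critical_pos_subspace (hF : ContDiff ℝ 2 F) (hK : IsCompact {x | F x ≤ 0})
    (hreg : ∀ x, F x = 0 → fderiv ℝ F x ≠ 0) (hv : v ≠ 0)
    (hP : ∀ p, F p = 0 → ∀ c : ℝ, 0 < c → fderiv ℝ F p = c • innerSL ℝ v →
      (∀ w, ⟪v, w⟫ = 0 → (∀ u, ⟪v, u⟫ = 0 → fderiv ℝ (fderiv ℝ F) p w u = 0) → w = 0) ∧
      ∃ P : Submodule ℝ E, (∀ w ∈ P, ⟪v, w⟫ = 0) ∧ finrank ℝ E ≤ finrank ℝ P + 2 ∧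
        ∀ w ∈ P, w ≠ 0 → 0 < fderiv ℝ (fderiv ℝ F) p w w) :
    ∃ t : ℝ, 0 < t ∧ ∃ η : ℝ, 0 < η ∧
      ∀ x, F x < η → x ∈ thickening 1 {x | F x ≤ 0} →
        fderiv ℝ (fun x => Real.exp (t * ⟪v, x⟫) * F x) x = 0 →
        F x < 0 ∧ ∃ V : Submodule ℝ E, finrank ℝ E ≤ finrank ℝ V + 1 ∧
          (∀ u ∈ V, u ≠ 0 →
            0 < fderiv ℝ (fderiv ℝ (fun x => Real.exp (t * ⟪v, x⟫) * F x)) x u u) ∧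
          (V ≠ ⊤ → ∃ w, fderiv ℝ (fderiv ℝ (fun x => Real.exp (t * ⟪v, x⟫) * F x)) x w w < 0) := by
  have hFd : Differentiable ℝ F := hF.differentiable (by norm_num)
  have hF1' : ContDiff ℝ 1 F := hF.of_le (by norm_num)
  have hFc : Continuous F := hF.continuous
  have hDc : Continuous (fderiv ℝ F) := hF.continuous_fderiv (by norm_num)
  have hvn : 0 < ‖v‖ := norm_pos_iff.2 hv
  set K : Set E := {x | F x ≤ 0} with hKdef
  set L : Set E := cthickening 1 K with hL
  have hLc : IsCompact L := hK.cthickening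
  have hKL : K ⊆ L := self_subset_cthickening K
  have hTL : thickening 1 K ⊆ L := thickening_subset_cthickening 1 K
  -- the upward-normal points and their local data
  let ι := {p : E // F p = 0 ∧ ∃ c : ℝ, 0 < c ∧ fderiv ℝ F p = c • innerSL ℝ v}
  have hdata : ∀ i : ι, ∃ (P' : Submodule ℝ E) (ρ q M n₀ : ℝ), 0 < ρ ∧ 0 < q ∧ 0 < M ∧ 0 < n₀ ∧
      (∀ w ∈ P', ⟪v, w⟫ = 0) ∧ finrank ℝ E ≤ finrank ℝ P' + 2 ∧
      (∀ x ∈ ball (i : E) ρ, ∀ w ∈ P', q * ‖w‖ ^ 2 ≤ fderiv ℝ (fderiv ℝ F) x w w) ∧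
      (∀ x ∈ ball (i : E) ρ, ‖fderiv ℝ (fderiv ℝ F) x‖ ≤ M) ∧
      (∀ x ∈ ball (i : E) ρ, n₀ ≤ fderiv ℝ F x (‖v‖⁻¹ • v)) ∧
      (finrank ℝ E ≤ finrank ℝ P' + 1 ∨
        ∃ w, ⟪v, w⟫ = 0 ∧ ∀ x ∈ ball (i : E) ρ, fderiv ℝ (fderiv ℝ F) x w w < 0) := by
    rintro ⟨p, hp0, c, hc, hDp⟩
    obtain ⟨hnd, P, hPv, hdimP, hPpos⟩ := hP p hp0 c hc hDp
    exact exists_local_data hF hv hc hDp hnd hPv hdimP hPpos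
  choose P' ρ q M n₀ hρ hq hM hn₀ hP'v hdimP' hQ hMb hn hneg using hdata
  -- the compact cone set and a finite subcover
  set C : Set E := {x | fderiv ℝ F x = ((‖v‖ ^ 2)⁻¹ * fderiv ℝ F x v) • innerSL ℝ v ∧
    0 ≤ fderiv ℝ F x v} with hC
  have hCc : IsClosed C := by
    have h1 : Continuous fun x => fderiv ℝ F x v :=
      (ContinuousLinearMap.apply ℝ ℝ v).continuous.comp hDc
    refine IsClosed.inter (isClosed_eq hDc ?_) (isClosed_le continuous_const h1)
    exact ((continuous_const.mul h1).smul continuous_const)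
  have hCiff : ∀ x, x ∈ C ↔ ∃ c : ℝ, 0 ≤ c ∧ fderiv ℝ F x = c • innerSL ℝ v := fun x => by
    rw [exists_nonneg_eq_smul_iff hv]; rfl
  set Cp : Set E := L ∩ F ⁻¹' {0} ∩ C with hCp
  have hCpc : IsCompact Cp :=
    (hLc.inter_right (isClosed_singleton.preimage hFc)).inter_right hCc
  have hcover : Cp ⊆ ⋃ i : ι, ball (i : E) (ρ i) := by
    rintro x ⟨⟨-, hx0⟩, hxC⟩
    obtain ⟨c, hc, hcx⟩ := (hCiff x).1 hxC
    have hcpos : 0 < c := by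
      rcases hc.lt_or_eq with hlt | heq
      · exact hlt
      · exfalso; apply hreg x hx0; rw [hcx, ← heq, zero_smul]
    exact mem_iUnion.2 ⟨⟨x, hx0, c, hcpos, hcx⟩, mem_ball_self (hρ _)⟩
  obtain ⟨s, hs⟩ := hCpc.elim_finite_subcover (fun i : ι => ball (i : E) (ρ i))
    (fun _ => isOpen_ball) hcover
  set W : Set E := ⋃ i ∈ s, ball (i : E) (ρ i) with hW
  have hWo : IsOpen W := isOpen_biUnion fun _ _ => isOpen_ball
  -- global constants
  obtain ⟨M₁, hM₁⟩ := hLc.exists_bound_of_continuousOn hDc.continuousOn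
  set M₂ : ℝ := max M₁ 0 with hM₂
  have hM₂0 : 0 ≤ M₂ := le_max_right _ _
  have hM₂b : ∀ x ∈ L, ‖fderiv ℝ F x‖ ≤ M₂ := fun x hx => (hM₁ x hx).trans (le_max_left _ _)
  obtain ⟨μ, hμ, ε₁, hε₁, hμε⟩ := exists_norm_fderiv_ge hF1' hLc (fun x _ hx => hreg x hx)
  obtain ⟨ε₂, hε₂, hcone⟩ := exists_pos_forall_mem_of_cone hF1' hv hLc hWo (W := W)
    (fun x hxL hx0 hc => hs ⟨⟨hxL, hx0⟩, (hCiff x).2 hc⟩)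
  set ε₃ : ℝ := min ε₁ ε₂ with hε₃
  have hε₃0 : 0 < ε₃ := lt_min hε₁ hε₂
  -- the rate `t`
  set T₂ : ι → ℝ := fun i => (2 * M i ^ 2 / q i + M i + 1) / (‖v‖ * n₀ i) with hT₂
  have hT₂0 : ∀ i, 0 ≤ T₂ i := fun i => by
    have := hq i; have := hM i; have := hn₀ i
    positivity
  set T₃ : ℝ := (M₂ + 1) / (ε₃ * ‖v‖) with hT₃
  have hT₃0 : 0 ≤ T₃ := by positivity
  set t : ℝ := T₃ + 1 + ∑ i ∈ s, T₂ i with ht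
  have hsum0 : 0 ≤ ∑ i ∈ s, T₂ i := Finset.sum_nonneg fun i _ => hT₂0 i
  have ht0 : 0 < t := by linarith
  have ht₂ : ∀ i ∈ s, 2 * M i ^ 2 / q i + M i + 1 ≤ t * ‖v‖ * n₀ i := by
    intro i hi
    have hvn₀ : 0 < ‖v‖ * n₀ i := mul_pos hvn (hn₀ i)
    have e2 : T₂ i * (‖v‖ * n₀ i) = 2 * M i ^ 2 / q i + M i + 1 := div_mul_cancel₀ _ hvn₀.ne'
    have hle : T₂ i ≤ t := by
      have := Finset.single_le_sum (fun j _ => hT₂0 j) hi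
      linarith
    rw [show t * ‖v‖ * n₀ i = t * (‖v‖ * n₀ i) by ring, ← e2]
    exact mul_le_mul_of_nonneg_right hle hvn₀.le
  have ht₃ : M₂ < t * ε₃ * ‖v‖ := by
    have e3 : T₃ * (ε₃ * ‖v‖) = M₂ + 1 := div_mul_cancel₀ _ (mul_pos hε₃0 hvn).ne'
    have hlt : T₃ < t := by linarith
    have : M₂ + 1 < t * (ε₃ * ‖v‖) := by
      rw [← e3]; exact mul_lt_mul_of_pos_right hlt (mul_pos hε₃0 hvn)
    rw [show t * ε₃ * ‖v‖ = t * (ε₃ * ‖v‖) by ring]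
    linarith
  -- the margin `η`
  set η : ℝ := min ε₁ (μ / (2 * t * ‖v‖)) with hη
  have hη0 : 0 < η := lt_min hε₁ (by positivity)
  set G : E → ℝ := fun x => Real.exp (t * ⟪v, x⟫) * F x with hG
  -- critical points with `F < 0` lie in `W`
  have hWcrit : ∀ y, F y < 0 → fderiv ℝ G y = 0 → y ∈ W := by
    intro y hy hyc
    have hyL : y ∈ L := hKL (le_of_lt hy)
    have hnorm : ‖fderiv ℝ F y‖ = |t * F y| * ‖v‖ := norm_fderiv_of_critical (hFd y) hyc
    have hshallow : -ε₃ < F y := by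
      by_contra hdeep
      push Not at hdeep
      have h1 : t * ε₃ * ‖v‖ ≤ ‖fderiv ℝ F y‖ := by
        rw [hnorm, abs_mul, abs_of_pos ht0, abs_of_neg hy]
        have : ε₃ ≤ -F y := by linarith
        gcongr
      linarith [hM₂b y hyL, h1, ht₃]
    refine hcone y hyL (by linarith [min_le_right ε₁ ε₂, hshallow]) hy.le
      ⟨-(t * F y), ?_, ?_⟩
    · rw [neg_mul_eq_mul_neg]
      exact (mul_pos ht0 (neg_pos.2 hy)).le
    · exact (fderiv_expHeight_eq_zero_iff t v (hFd y)).1 hyc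
  refine ⟨t, ht0, η, hη0, fun x hxη hxT hxc => ?_⟩
  have hxL : x ∈ L := hTL hxT
  -- `F x < 0`
  have hFx : F x < 0 := by
    rcases lt_trichotomy (F x) 0 with hneg' | hzero | hpos
    · exact hneg'
    · exfalso
      have := (fderiv_expHeight_eq_zero_iff t v (hFd x)).1 hxc
      rw [hzero, mul_zero, neg_zero, zero_smul] at this
      exact hreg x hzero this
    · exfalso
      have hxε : |F x| ≤ ε₁ := by
        rw [abs_of_pos hpos]; exact le_trans hxη.le (min_le_left _ _)
      have hlow := hμε x hxL hxε
      have hnorm : ‖fderiv ℝ F x‖ = |t * F x| * ‖v‖ := norm_fderiv_of_critical (hFd x) hxc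
      rw [hnorm, abs_of_pos (mul_pos ht0 hpos)] at hlow
      have hxη' : F x < μ / (2 * t * ‖v‖) := lt_of_lt_of_le hxη (min_le_right _ _)
      have h2 : t * F x * ‖v‖ < μ / 2 := by
        have h3 := mul_lt_mul_of_pos_left hxη' (mul_pos ht0 hvn)
        have e : t * ‖v‖ * (μ / (2 * t * ‖v‖)) = μ / 2 := by field_simp
        rw [e] at h3
        linarith
      linarith
  refine ⟨hFx, ?_⟩
  -- `x` lies in one of the balls
  obtain ⟨i, hi, hxi⟩ : ∃ i ∈ s, x ∈ ball (i : E) (ρ i) := by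
    have := hWcrit x hFx hxc
    simpa only [hW, mem_iUnion, exists_prop] using this
  set V : Submodule ℝ E := P' i ⊔ (ℝ ∙ v) with hV
  have hinf : P' i ⊓ (ℝ ∙ v) = ⊥ := by
    rw [Submodule.eq_bot_iff]
    rintro z ⟨hzP, hzv⟩
    obtain ⟨a, rfl⟩ := Submodule.mem_span_singleton.1 hzv
    have h0 : ⟪v, a • v⟫ = 0 := hP'v i _ hzP
    rw [inner_smul_right, real_inner_self_eq_norm_sq] at h0
    rcases mul_eq_zero.1 h0 with ha | hv0
    · rw [ha, zero_smul]
    · exfalso; exact hvn.ne' (pow_eq_zero_iff two_ne_zero |>.1 hv0)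
  have hVdim : finrank ℝ V = finrank ℝ (P' i) + 1 := by
    have h1 := Submodule.finrank_sup_add_finrank_inf_eq (P' i) (ℝ ∙ v)
    rw [hinf, finrank_bot, add_zero, finrank_span_singleton hv] at h1
    exact h1
  have hdimi := hdimP' i
  refine ⟨V, by rw [hVdim]; omega, fun u hu hu0 => ?_, fun hVtop => ?_⟩
  · exact fderiv_fderiv_expHeight_pos_of_mem hF hv (hq i) (hn₀ i) (hP'v i) (hQ i) (hMb i) (hn i)
      (ht₂ i hi) hxi hxc hu hu0
  · have hlt : finrank ℝ V < finrank ℝ E := Submodule.finrank_lt hVtop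
    rcases hneg i with hle | ⟨w, hw, hwneg⟩
    · exfalso; rw [hVdim] at hlt; omega
    · exact ⟨w, fderiv_fderiv_expHeight_neg_of_inner_eq_zero hF hxc hw (hwneg x hxi)⟩

end Global

/-! ### §4 Bridge to the tree's Morse theory: a handlebody of index at most one -/

section Manifold

variable {n : ℕ}

/-- **The chart Hessian on an open subset of `ℝⁿ⁺¹`** is the second Fréchet derivative:
`hessianInChart` of `G|U` in the preferred chart at `x` equals `D²G(x)`. [folklore] -/
theorem hessianInChart_comp_val_apply {U : TopologicalSpace.Opens (EuclideanSpace ℝ (Fin (n + 1)))}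
    (G : EuclideanSpace ℝ (Fin (n + 1)) → ℝ) (x : U) (u w : EuclideanSpace ℝ (Fin (n + 1))) :
    hessianInChart (𝓡 (n + 1)) (chartAt (EuclideanSpace ℝ (Fin (n + 1))) x) (fun y : U => G y) x u w =
      fderiv ℝ (fderiv ℝ G) x u w := by
  rw [hessianInChart_apply_apply, ModelWithCorners.Boundaryless.range_eq_univ, fderivWithin_univ,
    fderivWithin_univ, extend_apply_self, (comp_extend_symm_eventuallyEq G x).fderiv.fderiv_eq]

/-- **Nondegeneracy on an open subset of `ℝⁿ⁺¹`**: at a critical point of `G|U`, the tree's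
`mhessian` is nondegenerate as soon as `D²G(x)` is (symmetric and) separating. [folklore] -/
theorem nondegenerate_mhessian_comp_val_of_separating
    {U : TopologicalSpace.Opens (EuclideanSpace ℝ (Fin (n + 1)))}
    {G : EuclideanSpace ℝ (Fin (n + 1)) → ℝ} (hG : ContDiff ℝ 2 G) (x : U)
    (hx : IsMCriticalPt (𝓡 (n + 1)) (fun y : U => G y) x)
    (hsym : ∀ u w, fderiv ℝ (fderiv ℝ G) x u w = fderiv ℝ (fderiv ℝ G) x w u)
    (hsep : ∀ u, (∀ w, fderiv ℝ (fderiv ℝ G) x u w = 0) → u = 0) :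
    (mhessian (𝓡 (n + 1)) (fun y : U => G y) x).Nondegenerate := by
  have hf : ContMDiffAt (𝓡 (n + 1)) 𝓘(ℝ, ℝ) 2 (fun y : U => G y) x :=
    contMDiffAt_subtype_iff.2 (contMDiff_iff_contDiff.2 hG).contMDiffAt
  rw [nondegenerate_mhessian_iff hf hx (IsManifold.chart_mem_maximalAtlas x) (mem_chart_source _ x)]
  refine ⟨fun u hu => hsep u fun w => ?_, fun u hu => hsep u fun w => ?_⟩
  · rw [← hessianInChart_comp_val_apply G x]; exact hu w
  · rw [hsym, ← hessianInChart_comp_val_apply G x]; exact hu w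

/-- **Index bound on an open subset of `ℝⁿ⁺¹`**: at a critical point of `G|U`, if `D²G(x)` is
nonnegative on a subspace `V` then `morseIndex + dim V ≤ n + 1`. [folklore] -/
theorem morseIndex_comp_val_add_finrank_le
    {U : TopologicalSpace.Opens (EuclideanSpace ℝ (Fin (n + 1)))}
    {G : EuclideanSpace ℝ (Fin (n + 1)) → ℝ} (hG : ContDiff ℝ 2 G) (x : U)
    (hx : IsMCriticalPt (𝓡 (n + 1)) (fun y : U => G y) x)
    (V : Submodule ℝ (EuclideanSpace ℝ (Fin (n + 1))))
    (hV : ∀ u ∈ V, 0 ≤ fderiv ℝ (fderiv ℝ G) x u u) :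
    morseIndex (𝓡 (n + 1)) (fun y : U => G y) x + finrank ℝ V ≤ n + 1 := by
  have hf : ContMDiffAt (𝓡 (n + 1)) 𝓘(ℝ, ℝ) 2 (fun y : U => G y) x :=
    contMDiffAt_subtype_iff.2 (contMDiff_iff_contDiff.2 hG).contMDiffAt
  rw [morseIndex_eq_sigNeg_hessianInChart hf hx (IsManifold.chart_mem_maximalAtlas x)
    (mem_chart_source _ x)]
  have key := sigNeg_add_finrank_le
    (hessianInChart (𝓡 (n + 1)) (chartAt (EuclideanSpace ℝ (Fin (n + 1))) x) (fun y : U => G y) x) V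
    (fun u hu => by rw [hessianInChart_comp_val_apply G x]; exact hV u hu)
  rw [finrank_euclideanSpace_fin] at key
  exact key

/-- **The recognition input, manifold form: a compact regular domain whose upward-normal boundary
points are non-minima of the height is a handlebody of index `≤ 1`.**  Let `A = {F ≤ 0} ⊂ ℝⁿ⁺¹`
be a compact regular domain (`F` smooth, `DF ≠ 0` on `{F = 0}`) and `v ≠ 0` such that at every
boundary point `p` with `DF(p) = c ⟪v,·⟫`, `c > 0`, the restricted Hessian `D²F(p)|vᗮ` is
nondegenerate and positive on a subspace of codimension `≤ 1` in `vᗮ`.  Then `A`, as the regular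
sublevel set (`RegularSublevel`) of the exp-height function `e^{t⟪v,·⟫} F` on the open
neighbourhood `U = {F < η} ∩ (1-thickening of A)`, is compact and is a handlebody with handles
of index `≤ 1` (`IsHandlebodyOfIndexLE n 1`): by `exists_forall_critical_pos_subspace` that
function is Morse on `U` with `0` a regular level, `{· ≤ 0} = A`, and critical points of index
`≤ 1` (`sigNeg_add_finrank_le`, `eq_zero_of_forall_apply_eq_zero`), and the tree's
`RegularSublevel.morseData` makes it a Morse function adapted to `∂A` with the same critical
points and indices. [folklore] -/
theorem exists_regularSublevel_isHandlebodyOfIndexLE_one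
    {F : EuclideanSpace ℝ (Fin (n + 1)) → ℝ} {v : EuclideanSpace ℝ (Fin (n + 1))}
    (hF : ContDiff ℝ ∞ F) (hK : IsCompact {x | F x ≤ 0})
    (hreg : ∀ x, F x = 0 → fderiv ℝ F x ≠ 0) (hv : v ≠ 0)
    (hP : ∀ p, F p = 0 → ∀ c : ℝ, 0 < c → fderiv ℝ F p = c • innerSL ℝ v →
      (∀ w, ⟪v, w⟫ = 0 → (∀ u, ⟪v, u⟫ = 0 → fderiv ℝ (fderiv ℝ F) p w u = 0) → w = 0) ∧
      ∃ P : Submodule ℝ (EuclideanSpace ℝ (Fin (n + 1))), (∀ w ∈ P, ⟪v, w⟫ = 0) ∧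
        n + 1 ≤ finrank ℝ P + 2 ∧ ∀ w ∈ P, w ≠ 0 → 0 < fderiv ℝ (fderiv ℝ F) p w w) :
    ∃ (U : TopologicalSpace.Opens (EuclideanSpace ℝ (Fin (n + 1)))) (f : U → ℝ)
      (h0 : IsRegularLevel (𝓡 (n + 1)) f 0),
      {x | F x ≤ 0} ⊆ (U : Set (EuclideanSpace ℝ (Fin (n + 1)))) ∧ (∀ x : U, f x ≤ 0 ↔ F x ≤ 0) ∧
      (∀ x : U, f x = 0 ↔ F x = 0) ∧ CompactSpace (RegularSublevel h0) ∧
      IsHandlebodyOfIndexLE n 1 (RegularSublevel h0) := by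
  have hF2 : ContDiff ℝ 2 F := hF.of_le (by norm_cast)
  have hdim : finrank ℝ (EuclideanSpace ℝ (Fin (n + 1))) = n + 1 := finrank_euclideanSpace_fin
  obtain ⟨t, ht, η, hη, hcrit⟩ := exists_forall_critical_pos_subspace hF2 hK hreg hv
    (fun p hp0 c hc hDp => by
      obtain ⟨hnd, P, hPv, hPdim, hPpos⟩ := hP p hp0 c hc hDp
      exact ⟨hnd, P, hPv, by have := hdim; omega, hPpos⟩)
  have hFc : Continuous F := hF.continuous
  set K : Set (EuclideanSpace ℝ (Fin (n + 1))) := {x | F x ≤ 0} with hKdef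
  set G : EuclideanSpace ℝ (Fin (n + 1)) → ℝ := fun x => Real.exp (t * ⟪v, x⟫) * F x with hG
  have hGs : ContDiff ℝ ∞ G := contDiff_expHeight hF t v
  have hG2 : ContDiff ℝ 2 G := contDiff_expHeight hF2 t v
  have hsymG : ∀ x u w, fderiv ℝ (fderiv ℝ G) x u w = fderiv ℝ (fderiv ℝ G) x w u := fun x u w =>
    (hG2.contDiffAt.isSymmSndFDerivAt (by simp)) u w
  -- the open neighbourhood `U`
  set Us : Set (EuclideanSpace ℝ (Fin (n + 1))) := thickening 1 K ∩ F ⁻¹' Iio η with hUs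
  have hUo : IsOpen Us := isOpen_thickening.inter (isOpen_Iio.preimage hFc)
  set U : TopologicalSpace.Opens (EuclideanSpace ℝ (Fin (n + 1))) := ⟨Us, hUo⟩ with hU
  have hKU : K ⊆ (U : Set (EuclideanSpace ℝ (Fin (n + 1)))) := fun x hx =>
    ⟨self_subset_thickening one_pos K hx, lt_of_le_of_lt (show F x ≤ 0 from hx) hη⟩
  set f : U → ℝ := fun y => G y with hf
  have hfs : ContMDiff (𝓡 (n + 1)) 𝓘(ℝ, ℝ) ∞ f :=
    fun y => contMDiffAt_subtype_iff.2 (contMDiff_iff_contDiff.2 hGs).contMDiffAt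
  -- data at the critical points of `f`
  have hcritf : ∀ y : U, IsMCriticalPt (𝓡 (n + 1)) f y →
      F y < 0 ∧ ∃ V : Submodule ℝ (EuclideanSpace ℝ (Fin (n + 1))),
        n + 1 ≤ finrank ℝ V + 1 ∧
        (∀ u ∈ V, u ≠ 0 → 0 < fderiv ℝ (fderiv ℝ G) y u u) ∧
        (V ≠ ⊤ → ∃ w, fderiv ℝ (fderiv ℝ G) y w w < 0) := by
    intro y hy
    have hyc : fderiv ℝ G y = 0 := (isMCriticalPt_comp_val_iff hG2 y).1 hy
    obtain ⟨hFy, V, hVdim, hVpos, hVneg⟩ := hcrit y y.2.2 y.2.1 hyc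
    exact ⟨hFy, V, by have := hdim; omega, hVpos, hVneg⟩
  -- `0` is a regular level
  have h0 : IsRegularLevel (𝓡 (n + 1)) f 0 := by
    refine ⟨hfs, fun y _ => BoundarylessManifold.isInteriorPoint, fun y hy hyc => ?_⟩
    have hy0 : F y = 0 := (expHeight_eq_zero_iff t v F y).1 hy
    exact absurd hy0 (hcritf y hyc).1.ne
  refine ⟨U, f, h0, hKU, fun y => expHeight_nonpos_iff t v F y, fun y => expHeight_eq_zero_iff t v F y,
    ?_⟩
  -- Morse
  have hMorse : IsMorse (𝓡 (n + 1)) f := by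
    refine ⟨hfs, fun y hy => ?_⟩
    obtain ⟨-, V, hVdim, hVpos, hVneg⟩ := hcritf y hy
    exact nondegenerate_mhessian_comp_val_of_separating hG2 y hy (hsymG y) fun u hu =>
      eq_zero_of_forall_apply_eq_zero (fderiv ℝ (fderiv ℝ G) y) (hsymG y) V hVpos
        (by have := hdim; omega) hVneg hu
  -- compactness
  have hKc : IsCompact (f ⁻¹' Iic 0) := by
    have himg : Subtype.val '' (f ⁻¹' Iic (0 : ℝ)) = K := by
      ext x
      simp only [mem_image, mem_preimage, mem_Iic, Subtype.exists, exists_and_right, exists_eq_right]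
      constructor
      · rintro ⟨hx, hfx⟩
        exact (expHeight_nonpos_iff t v F x).1 hfx
      · intro hx
        exact ⟨hKU hx, (expHeight_nonpos_iff t v F x).2 hx⟩
    rw [Topology.IsEmbedding.subtypeVal.isCompact_iff, himg]
    exact hK
  haveI hcs : CompactSpace (RegularSublevel h0) := isCompact_iff_compactSpace.1 hKc
  refine ⟨hcs, ?_⟩
  -- the adapted Morse function and the index bound
  obtain ⟨hadapt, hiff, hind⟩ := RegularSublevel.morseData hMorse h0
  refine ⟨_, hadapt, fun z hz => ?_⟩
  have hzc : IsMCriticalPt (𝓡 (n + 1)) f (RegularSublevel.incl h0 z) := (hiff z).1 hz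
  rw [hind z hzc]
  set y := RegularSublevel.incl h0 z with hy
  obtain ⟨-, V, hVdim, hVpos, -⟩ := hcritf y hzc
  have key := morseIndex_comp_val_add_finrank_le hG2 y hzc V (fun u hu => by
    by_cases hu0 : u = 0
    · simp [hu0]
    · exact (hVpos u hu hu0).le)
  have hkey : morseIndex (𝓡 (n + 1)) f y + finrank ℝ V ≤ n + 1 := key
  omega

end Manifold

end ExpHeight

end Literature.Topology.FourManifolds
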